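import Summits.CriticalPhenomena.SAWScalingLimit.Theorems.SAWRenewalTightnessTubeLowerBoundDominoStaircaseHelpers
import Summits.CriticalPhenomena.SAWScalingLimit.Theorems.SAWRenewalTightnessTubeLowerBoundDominoFloor
import Summits.CriticalPhenomena.SAWScalingLimit.Theorems.SAWRenewalTightnessTubeLowerBoundQuarterFlux

/-!
# Crux `TubeLowerBound` (stmt-CriticalPhenomena-4730), line `Sketch` (= lasso-repair-poly-hw): the domino
staircase (stub S3 `stub_dominoStaircase`)

`stub_dominoStaircase : lasso inequality → count ceiling → FirstOctantTubeFloor`.  For naturals `b ≤ a` and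
`ℓ₀ = max(1, |(a, b)|)`, tube-confined self-avoiding walks `0 → (a, b)` are produced along the corner staircase
`Q_j = (⌊j a/n⌋, ⌊j b/n⌋)`, `n = min(20, a)` (`CornerStaircase.nR/xc/yc`): each of the `2n ≤ 40` legs is a parity
unit step plus one generalised domino (`DominoStaircase.piece`, at most `4` pieces a round, `≤ 80` in all), every
piece glued to the walk so far by the LASSO INEQUALITY (first hypothesis) inside the tube predicate — pieces
overlap, no separation or injectivity is needed — at a cost made polynomial by the COUNT CEILING (second
hypothesis, `c_k x_c^k ≤ (k+1)^C`, replaced by `⌈C⌉`).  Bookkeeping: with `W = 721 ℓ₀²` every budget is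
`≤ 80 (8a² + 1) ≤ W − 1`, every piece has mass `≥ x_c/(16(2a+1)) ≥ x_c/W`, so each piece multiplies the floor by
`γ = x_c / W^{2⌈C⌉+4}` (`legH`, `legV`, `roundD`); after `n` rounds the mass is `≥ γ^{4n} ≥ γ^{80} = c' ℓ₀^{−C'}` with
`C' = 160 (2⌈C⌉ + 4)`, `c' = (x_c / 721^{2⌈C⌉+4})^{80}`.  The dominoes are the landed
`stub_dominoFloor stub_quarterFlux : DominoFloor`; the tube geometry is `DominoStaircase.tube_of_HD/VD`.
-/

noncomputable section

namespace Summit.CriticalPhenomena.SAWScalingLimit.Theorems.TubeLowerBound.LassoRepair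

open scoped BigOperators Classical
open Literature.Probability.LatticeModels
open Literature.Probability.RandomPlanarGeometry Literature.Probability.RandomPlanarGeometry.SAW
open Literature.Probability.Percolation.Contour (site_ext)
open Summit.CriticalPhenomena.SAWScalingLimit.Theorems.TubeLowerBound.LiebSimonStar
open Summit.CriticalPhenomena.SAWScalingLimit.Theorems.TubeLowerBound.LiebSimonStar.CornerStaircase

namespace DominoStaircase

section Lasso

variable (hL : ∀ (P Q R : Site 2 → Prop) [DecidablePred P] [DecidablePred Q] [DecidablePred R]
      (e₁ e₂ e : Site 2), e₁ + e₂ = e → (∀ p, P p → R p) → (∀ q, Q q → R (e₁ + q)) → ∀ (M N : ℕ),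
      (∑ m ∈ Finset.range (M + 1),
          ∑ _ω ∈ (Zd.sawFun 2 m e₁).filter (fun ω => ∀ i ≤ m, P (ω i)), criticalFugacity ^ m) *
        (∑ n ∈ Finset.range (N + 1),
          ∑ _ω ∈ (Zd.sawFun 2 n e₂).filter (fun ω => ∀ i ≤ n, Q (ω i)), criticalFugacity ^ n) ≤
      ((M : ℝ) + 1) * (∑ k ∈ Finset.range (M + 1), (Zd.count 2 k : ℝ) * criticalFugacity ^ k) *
        (∑ k ∈ Finset.range (N + 1), (Zd.count 2 k : ℝ) * criticalFugacity ^ k) *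
        ∑ k ∈ Finset.range (M + N + 1),
          ∑ _ω ∈ (Zd.sawFun 2 k e).filter (fun ω => ∀ i ≤ k, R (ω i)), criticalFugacity ^ k)
  {Cn : ℕ} (hC : ∀ n : ℕ, (Zd.count 2 n : ℝ) * criticalFugacity ^ n ≤ ((n : ℝ) + 1) ^ Cn)
  (hD : DominoFloor) {a b : ℕ} (hba : b ≤ a) {γ : ℝ} (hγ0 : 0 ≤ γ) (hγ1 : γ ≤ 1)
  (hγW : γ * (((80 * (8 * a ^ 2 + 1) : ℕ) : ℝ) + 1) ^ (2 * Cn + 3) ≤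
    criticalFugacity / (16 * (2 * (a : ℝ) + 1)))

include hL hC hD hba hγ0 hγ1 hγW in
/-- **The horizontal leg of round `j + 1`** (`Q_j → (x_{j+1}, y_j)`, length `L = x_{j+1} − x_j ≥ 1`): a unit
east step if `L` is even, then the horizontal generalised domino of radius `⌊(L−1)/2⌋`; two pieces (padded
with `γ ≤ 1` when fewer are used). -/
theorem legH {j : ℕ} (hj : j + 1 ≤ nR a) {k M : ℕ} (hk : k + 2 ≤ 80) (hM : M ≤ k * (8 * a ^ 2 + 1))
    (hB : γ ^ k ≤ ∑ n ∈ Finset.range (M + 1),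
        ∑ _ω ∈ (Zd.sawFun 2 n ![((xc a j : ℕ) : ℤ), ((yc a b j : ℕ) : ℤ)]).filter
          (fun ω => ∀ i ≤ n, ω i ∈ tubeSet a b), criticalFugacity ^ n) :
    ∃ M' : ℕ, M' ≤ (k + 2) * (8 * a ^ 2 + 1) ∧
      γ ^ (k + 2) ≤ ∑ n ∈ Finset.range (M' + 1),
          ∑ _ω ∈ (Zd.sawFun 2 n ![((xc a (j + 1) : ℕ) : ℤ), ((yc a b j : ℕ) : ℤ)]).filter
            (fun ω => ∀ i ≤ n, ω i ∈ tubeSet a b), criticalFugacity ^ n := by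
  obtain ⟨hq1, -, hx1, -, -, -, hxa⟩ := corner_facts hba hj
  -- an optional parity step, to an abscissa `c` with `c + 2R + 1 = x_{j+1}`, `R = ⌊(L-1)/2⌋`
  obtain ⟨c, M₁, hc, hc', hM₁, hB₁⟩ : ∃ c M₁ : ℕ, xc a j ≤ c ∧
      c + 2 * ((xc a (j + 1) - xc a j - 1) / 2) + 1 = xc a (j + 1) ∧
      M₁ ≤ (k + 1) * (8 * a ^ 2 + 1) ∧
      γ ^ (k + 1) ≤ ∑ n ∈ Finset.range (M₁ + 1),
          ∑ _ω ∈ (Zd.sawFun 2 n ![(c : ℤ), ((yc a b j : ℕ) : ℤ)]).filter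
            (fun ω => ∀ i ≤ n, ω i ∈ tubeSet a b), criticalFugacity ^ n := by
    rcases Nat.even_or_odd (xc a (j + 1) - xc a j) with ⟨r, hr⟩ | ⟨r, hr⟩
    · -- the unit east step at `Q_j` lies in the tube
      have hQ : ∀ q : Site 2, (-((0 : ℕ) : ℤ) ≤ q 0 ∧ q 0 ≤ 3 * ((0 : ℕ) : ℤ) + 1 ∧ |q 1| ≤ ((0 : ℕ) : ℤ)) →
          (![((xc a j : ℕ) : ℤ), ((yc a b j : ℕ) : ℤ)] : Site 2) + q ∈ tubeSet a b := by
        rintro q ⟨hq0, hq0', hq1⟩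
        rw [abs_le] at hq1
        push_cast at hq0 hq0' hq1
        have c0 : ((![((xc a j : ℕ) : ℤ), ((yc a b j : ℕ) : ℤ)] : Site 2) + q) 0 = xc a j + q 0 := by simp
        have c1 : ((![((xc a j : ℕ) : ℤ), ((yc a b j : ℕ) : ℤ)] : Site 2) + q) 1 = yc a b j + q 1 := by
          simp
        exact tube_of_HD (R := 0) hj (c := xc a j) le_rfl (by push_cast; omega) (by rw [c0]; push_cast; omega)
          (by rw [c0]; push_cast; omega) (by rw [c1]; push_cast; omega) (by rw [c1]; push_cast; omega)
      have hp := piece hL hC hγ0 hγW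
        (Q := fun q : Site 2 => -((0 : ℕ) : ℤ) ≤ q 0 ∧ q 0 ≤ 3 * ((0 : ℕ) : ℤ) + 1 ∧ |q 1| ≤ ((0 : ℕ) : ℤ))
        (e₁ := ![((xc a j : ℕ) : ℤ), ((yc a b j : ℕ) : ℤ)]) (e₂ := ![2 * ((0 : ℕ) : ℤ) + 1, 0]) (b := b)
        (Nat.zero_le a)
      obtain ⟨M₁, hM₁, hB₁⟩ := hp (generalDominoFloor hD 0) hQ (by omega) hM hB
      refine ⟨xc a j + 1, M₁, by omega, by omega, hM₁, ?_⟩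
      have he : (![((xc a j : ℕ) : ℤ), ((yc a b j : ℕ) : ℤ)] : Site 2) + ![2 * ((0 : ℕ) : ℤ) + 1, 0] =
          ![((xc a j + 1 : ℕ) : ℤ), ((yc a b j : ℕ) : ℤ)] := site_ext (by simp) (by simp)
      rwa [he] at hB₁
    · refine ⟨xc a j, M, le_rfl, by omega, hM.trans (Nat.mul_le_mul_right _ (by omega)), ?_⟩
      exact (pow_le_pow_of_le_one hγ0 hγ1 (by omega)).trans hB
  -- the horizontal generalised domino of radius `R` at abscissa `c`
  set R := (xc a (j + 1) - xc a j - 1) / 2 with hR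
  have hQ : ∀ q : Site 2, (-(R : ℤ) ≤ q 0 ∧ q 0 ≤ 3 * (R : ℤ) + 1 ∧ |q 1| ≤ (R : ℤ)) →
      (![(c : ℤ), ((yc a b j : ℕ) : ℤ)] : Site 2) + q ∈ tubeSet a b := by
    rintro q ⟨hq0, hq0', hq1⟩
    rw [abs_le] at hq1
    have c0 : ((![(c : ℤ), ((yc a b j : ℕ) : ℤ)] : Site 2) + q) 0 = c + q 0 := by simp
    have c1 : ((![(c : ℤ), ((yc a b j : ℕ) : ℤ)] : Site 2) + q) 1 = yc a b j + q 1 := by simp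
    exact tube_of_HD (R := R) hj (c := c) (by exact_mod_cast hc) (by exact_mod_cast hc'.le)
      (by rw [c0]; omega) (by rw [c0]; omega) (by rw [c1]; omega) (by rw [c1]; omega)
  have hp := piece hL hC hγ0 hγW
    (Q := fun q : Site 2 => -(R : ℤ) ≤ q 0 ∧ q 0 ≤ 3 * (R : ℤ) + 1 ∧ |q 1| ≤ (R : ℤ))
    (e₁ := ![(c : ℤ), ((yc a b j : ℕ) : ℤ)]) (e₂ := ![2 * (R : ℤ) + 1, 0]) (b := b) (by omega : R ≤ a)
  obtain ⟨M', hM', hB'⟩ := hp (generalDominoFloor hD R) hQ (by omega : k + 1 + 1 ≤ 80) hM₁ hB₁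
  refine ⟨M', ?_, ?_⟩
  · calc M' ≤ (k + 1 + 1) * (8 * a ^ 2 + 1) := hM'
      _ = (k + 2) * (8 * a ^ 2 + 1) := by ring
  · have he : (![(c : ℤ), ((yc a b j : ℕ) : ℤ)] : Site 2) + ![2 * (R : ℤ) + 1, 0] =
        ![((xc a (j + 1) : ℕ) : ℤ), ((yc a b j : ℕ) : ℤ)] :=
      site_ext (by simp only [Pi.add_apply, Matrix.cons_val_zero]; omega) (by simp)
    rw [he] at hB'
    exact hB'

include hL hC hD hba hγ0 hγ1 hγW in
/-- **The vertical leg of round `j + 1`** (`(x_{j+1}, y_j) → Q_{j+1}`, length `L = y_{j+1} − y_j ≥ 0`): nothing if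
`L = 0`; otherwise a unit north step if `L` is even, then the vertical generalised domino of radius
`⌊(L−1)/2⌋`; two pieces (padded). -/
theorem legV {j : ℕ} (hj : j + 1 ≤ nR a) {k M : ℕ} (hk : k + 2 ≤ 80) (hM : M ≤ k * (8 * a ^ 2 + 1))
    (hB : γ ^ k ≤ ∑ n ∈ Finset.range (M + 1),
        ∑ _ω ∈ (Zd.sawFun 2 n ![((xc a (j + 1) : ℕ) : ℤ), ((yc a b j : ℕ) : ℤ)]).filter
          (fun ω => ∀ i ≤ n, ω i ∈ tubeSet a b), criticalFugacity ^ n) :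
    ∃ M' : ℕ, M' ≤ (k + 2) * (8 * a ^ 2 + 1) ∧
      γ ^ (k + 2) ≤ ∑ n ∈ Finset.range (M' + 1),
          ∑ _ω ∈ (Zd.sawFun 2 n ![((xc a (j + 1) : ℕ) : ℤ), ((yc a b (j + 1) : ℕ) : ℤ)]).filter
            (fun ω => ∀ i ≤ n, ω i ∈ tubeSet a b), criticalFugacity ^ n := by
  obtain ⟨hq1, hqa, -, -, hy1, hy2, hxa⟩ := corner_facts hba hj
  rcases Nat.eq_or_lt_of_le hy1 with hy | hy
  · -- empty vertical leg
    refine ⟨M, hM.trans (Nat.mul_le_mul_right _ (by omega)), ?_⟩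
    rw [← hy]
    exact (pow_le_pow_of_le_one hγ0 hγ1 (by omega)).trans hB
  -- an optional parity step, to an ordinate `c` with `c + 2R + 1 = y_{j+1}`, `R = ⌊(L-1)/2⌋`
  obtain ⟨c, M₁, hc, hc', hM₁, hB₁⟩ : ∃ c M₁ : ℕ, yc a b j ≤ c ∧
      c + 2 * ((yc a b (j + 1) - yc a b j - 1) / 2) + 1 = yc a b (j + 1) ∧
      M₁ ≤ (k + 1) * (8 * a ^ 2 + 1) ∧
      γ ^ (k + 1) ≤ ∑ n ∈ Finset.range (M₁ + 1),
          ∑ _ω ∈ (Zd.sawFun 2 n ![((xc a (j + 1) : ℕ) : ℤ), (c : ℤ)]).filter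
            (fun ω => ∀ i ≤ n, ω i ∈ tubeSet a b), criticalFugacity ^ n := by
    rcases Nat.even_or_odd (yc a b (j + 1) - yc a b j) with ⟨r, hr⟩ | ⟨r, hr⟩
    · -- the unit north step at `(x_{j+1}, y_j)` lies in the tube
      have hQ : ∀ q : Site 2, (-((0 : ℕ) : ℤ) ≤ q 1 ∧ q 1 ≤ 3 * ((0 : ℕ) : ℤ) + 1 ∧ |q 0| ≤ ((0 : ℕ) : ℤ)) →
          (![((xc a (j + 1) : ℕ) : ℤ), ((yc a b j : ℕ) : ℤ)] : Site 2) + q ∈ tubeSet a b := by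
        rintro q ⟨hq1', hq1'', hq0⟩
        rw [abs_le] at hq0
        push_cast at hq1' hq1'' hq0
        have c0 : ((![((xc a (j + 1) : ℕ) : ℤ), ((yc a b j : ℕ) : ℤ)] : Site 2) + q) 0 =
            xc a (j + 1) + q 0 := by simp
        have c1 : ((![((xc a (j + 1) : ℕ) : ℤ), ((yc a b j : ℕ) : ℤ)] : Site 2) + q) 1 =
            yc a b j + q 1 := by simp
        exact tube_of_VD (R := 0) hba hj (c := yc a b j) le_rfl (by push_cast; omega)
          (by rw [c0]; push_cast; omega) (by rw [c0]; push_cast; omega) (by rw [c1]; push_cast; omega)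
          (by rw [c1]; push_cast; omega)
      have hp := piece hL hC hγ0 hγW
        (Q := fun q : Site 2 => -((0 : ℕ) : ℤ) ≤ q 1 ∧ q 1 ≤ 3 * ((0 : ℕ) : ℤ) + 1 ∧ |q 0| ≤ ((0 : ℕ) : ℤ))
        (e₁ := ![((xc a (j + 1) : ℕ) : ℤ), ((yc a b j : ℕ) : ℤ)]) (e₂ := ![0, 2 * ((0 : ℕ) : ℤ) + 1]) (b := b)
        (Nat.zero_le a)
      obtain ⟨M₁, hM₁, hB₁⟩ := hp (domV_floor hD 0) hQ (by omega) hM hB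
      refine ⟨yc a b j + 1, M₁, by omega, by omega, hM₁, ?_⟩
      have he : (![((xc a (j + 1) : ℕ) : ℤ), ((yc a b j : ℕ) : ℤ)] : Site 2) + ![0, 2 * ((0 : ℕ) : ℤ) + 1] =
          ![((xc a (j + 1) : ℕ) : ℤ), ((yc a b j + 1 : ℕ) : ℤ)] := site_ext (by simp) (by simp)
      rwa [he] at hB₁
    · refine ⟨yc a b j, M, le_rfl, by omega, hM.trans (Nat.mul_le_mul_right _ (by omega)), ?_⟩
      exact (pow_le_pow_of_le_one hγ0 hγ1 (by omega)).trans hB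
  -- the vertical generalised domino of radius `R` at ordinate `c`
  set R := (yc a b (j + 1) - yc a b j - 1) / 2 with hR
  have hQ : ∀ q : Site 2, (-(R : ℤ) ≤ q 1 ∧ q 1 ≤ 3 * (R : ℤ) + 1 ∧ |q 0| ≤ (R : ℤ)) →
      (![((xc a (j + 1) : ℕ) : ℤ), (c : ℤ)] : Site 2) + q ∈ tubeSet a b := by
    rintro q ⟨hq1', hq1'', hq0⟩
    rw [abs_le] at hq0
    have c0 : ((![((xc a (j + 1) : ℕ) : ℤ), (c : ℤ)] : Site 2) + q) 0 = xc a (j + 1) + q 0 := by simp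
    have c1 : ((![((xc a (j + 1) : ℕ) : ℤ), (c : ℤ)] : Site 2) + q) 1 = c + q 1 := by simp
    exact tube_of_VD (R := R) hba hj (c := c) (by exact_mod_cast hc) (by exact_mod_cast hc'.le)
      (by rw [c0]; omega) (by rw [c0]; omega) (by rw [c1]; omega) (by rw [c1]; omega)
  have hp := piece hL hC hγ0 hγW
    (Q := fun q : Site 2 => -(R : ℤ) ≤ q 1 ∧ q 1 ≤ 3 * (R : ℤ) + 1 ∧ |q 0| ≤ (R : ℤ))
    (e₁ := ![((xc a (j + 1) : ℕ) : ℤ), (c : ℤ)]) (e₂ := ![0, 2 * (R : ℤ) + 1]) (b := b) (by omega : R ≤ a)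
  obtain ⟨M', hM', hB'⟩ := hp (domV_floor hD R) hQ (by omega : k + 1 + 1 ≤ 80) hM₁ hB₁
  refine ⟨M', ?_, ?_⟩
  · calc M' ≤ (k + 1 + 1) * (8 * a ^ 2 + 1) := hM'
      _ = (k + 2) * (8 * a ^ 2 + 1) := by ring
  · have he : (![((xc a (j + 1) : ℕ) : ℤ), (c : ℤ)] : Site 2) + ![0, 2 * (R : ℤ) + 1] =
        ![((xc a (j + 1) : ℕ) : ℤ), ((yc a b (j + 1) : ℕ) : ℤ)] :=
      site_ext (by simp) (by simp only [Pi.add_apply, Matrix.cons_val_one, Matrix.cons_val_zero]; omega)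
    rw [he] at hB'
    exact hB'

include hL hC hD hba hγ0 hγ1 hγW in
/-- **One round**: the floor `γ^{4j}` at `Q_j` within budget `4j (8a²+1)` becomes `γ^{4(j+1)}` at `Q_{j+1}` within
budget `4(j+1) (8a²+1)` (horizontal leg, then vertical leg; `4(j+1) ≤ 80` as `j + 1 ≤ n ≤ 20`). -/
theorem roundD {j : ℕ} (hj : j + 1 ≤ nR a) {M : ℕ} (hM : M ≤ 4 * j * (8 * a ^ 2 + 1))
    (hB : γ ^ (4 * j) ≤ ∑ n ∈ Finset.range (M + 1),
        ∑ _ω ∈ (Zd.sawFun 2 n ![((xc a j : ℕ) : ℤ), ((yc a b j : ℕ) : ℤ)]).filter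
          (fun ω => ∀ i ≤ n, ω i ∈ tubeSet a b), criticalFugacity ^ n) :
    ∃ M' : ℕ, M' ≤ 4 * (j + 1) * (8 * a ^ 2 + 1) ∧
      γ ^ (4 * (j + 1)) ≤ ∑ n ∈ Finset.range (M' + 1),
          ∑ _ω ∈ (Zd.sawFun 2 n ![((xc a (j + 1) : ℕ) : ℤ), ((yc a b (j + 1) : ℕ) : ℤ)]).filter
            (fun ω => ∀ i ≤ n, ω i ∈ tubeSet a b), criticalFugacity ^ n := by
  have hj20 : j + 1 ≤ 20 := hj.trans (min_le_left 20 a)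
  obtain ⟨M₁, hM₁, hB₁⟩ := legH hL hC hD hba hγ0 hγ1 hγW hj (k := 4 * j) (by omega) hM hB
  obtain ⟨M₂, hM₂, hB₂⟩ := legV hL hC hD hba hγ0 hγ1 hγW hj (k := 4 * j + 2) (by omega) hM₁ hB₁
  refine ⟨M₂, ?_, ?_⟩
  · calc M₂ ≤ (4 * j + 2 + 2) * (8 * a ^ 2 + 1) := hM₂
      _ = 4 * (j + 1) * (8 * a ^ 2 + 1) := by ring
  · rw [show 4 * (j + 1) = 4 * j + 2 + 2 by ring]
    exact hB₂

end Lasso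

end DominoStaircase

open DominoStaircase in
/-- **Stub S3 of the line `Sketch` (= lasso-repair-poly-hw): the domino staircase.**  The two-piece lasso
inequality and the count ceiling `c_n x_c^n ≤ (n+1)^C` give `FirstOctantTubeFloor`: for `0 ≤ b ≤ a`,
`ℓ₀ = max(1, |(a,b)|)`, the `x_c`-mass of self-avoiding walks `0 → (a, b)` within `ℓ₀/10 + 2` of `[0, (a,b)]` is
`≥ c' ℓ₀^{−C'}` with `C' = 160 (2⌈C⌉ + 4)`, `c' = (x_c / 721^{2⌈C⌉+4})^{80}` — `≤ 80` generalised dominoes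
(`stub_dominoFloor stub_quarterFlux`) along the corner staircase, glued with overlaps by the lasso inequality. -/
theorem stub_dominoStaircase :
    (∀ (P Q R : Site 2 → Prop) [DecidablePred P] [DecidablePred Q] [DecidablePred R]
      (e₁ e₂ e : Site 2), e₁ + e₂ = e → (∀ p, P p → R p) → (∀ q, Q q → R (e₁ + q)) → ∀ (M N : ℕ),
      (∑ m ∈ Finset.range (M + 1),
          ∑ _ω ∈ (Zd.sawFun 2 m e₁).filter (fun ω => ∀ i ≤ m, P (ω i)), criticalFugacity ^ m) *
        (∑ n ∈ Finset.range (N + 1),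
          ∑ _ω ∈ (Zd.sawFun 2 n e₂).filter (fun ω => ∀ i ≤ n, Q (ω i)), criticalFugacity ^ n) ≤
      ((M : ℝ) + 1) * (∑ k ∈ Finset.range (M + 1), (Zd.count 2 k : ℝ) * criticalFugacity ^ k) *
        (∑ k ∈ Finset.range (N + 1), (Zd.count 2 k : ℝ) * criticalFugacity ^ k) *
        ∑ k ∈ Finset.range (M + N + 1),
          ∑ _ω ∈ (Zd.sawFun 2 k e).filter (fun ω => ∀ i ≤ k, R (ω i)), criticalFugacity ^ k) →
    (∃ C : ℝ, 0 ≤ C ∧ ∀ n : ℕ, (Zd.count 2 n : ℝ) * criticalFugacity ^ n ≤ ((n : ℝ) + 1) ^ C) →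
    FirstOctantTubeFloor := by
  intro hL hCe
  obtain ⟨C, hC0, hC⟩ := hCe
  have hC' : ∀ n : ℕ, (Zd.count 2 n : ℝ) * criticalFugacity ^ n ≤ ((n : ℝ) + 1) ^ ⌈C⌉₊ := fun n =>
    (hC n).trans (by
      rw [← Real.rpow_natCast]
      exact Real.rpow_le_rpow_of_exponent_le (by linarith [(Nat.cast_nonneg n : (0 : ℝ) ≤ n)])
        (Nat.le_ceil C))
  have hD : DominoFloor := stub_dominoFloor stub_quarterFlux
  have hx1 : criticalFugacity ≤ 1 := by
    have h := Zd.one_le_connectiveConstant 2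
    rw [Zd.connectiveConstant_two] at h
    exact inv_le_one_of_one_le₀ h
  obtain ⟨D, hDdef⟩ : ∃ D : ℕ, D = 2 * ⌈C⌉₊ + 3 := ⟨_, rfl⟩
  refine ⟨((160 * (D + 1) : ℕ) : ℝ), (criticalFugacity / 721 ^ (D + 1)) ^ 80, by positivity,
    pow_pos (div_pos criticalFugacity_pos (pow_pos (by norm_num) _)) 80, fun a b hba => ?_⟩
  set ℓ₀ := max 1 (dist (Site.toComplex (0 : Site 2)) (Site.toComplex (![(a : ℤ), (b : ℤ)] : Site 2)))
    with hℓ₀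
  have hℓ1 : 1 ≤ ℓ₀ := le_max_left _ _
  have hℓ0 : 0 < ℓ₀ := by positivity
  have haℓ : (a : ℝ) ≤ ℓ₀ := cast_le_ell0 a b
  have ha2 : (a : ℝ) ^ 2 ≤ ℓ₀ ^ 2 := pow_le_pow_left₀ (Nat.cast_nonneg a) haℓ 2
  have hℓ2 : ℓ₀ ≤ ℓ₀ ^ 2 := by nlinarith
  obtain ⟨W, hW⟩ : ∃ W : ℝ, W = 721 * ℓ₀ ^ 2 := ⟨_, rfl⟩
  have hW1 : 1 ≤ W := by rw [hW]; nlinarith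
  have hW0 : 0 < W := by linarith
  obtain ⟨γ, hγ⟩ : ∃ γ : ℝ, γ = criticalFugacity / W ^ (D + 1) := ⟨_, rfl⟩
  have hγ0 : 0 ≤ γ := by rw [hγ]; exact div_nonneg criticalFugacity_pos.le (pow_nonneg hW0.le _)
  have hγ1 : γ ≤ 1 := by
    rw [hγ]; exact (div_le_self criticalFugacity_pos.le (one_le_pow₀ hW1)).trans hx1
  have hγW : γ * (((80 * (8 * a ^ 2 + 1) : ℕ) : ℝ) + 1) ^ (2 * ⌈C⌉₊ + 3) ≤
      criticalFugacity / (16 * (2 * (a : ℝ) + 1)) := by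
    have hMW : (((80 * (8 * a ^ 2 + 1) : ℕ) : ℝ) + 1) ≤ W := by
      rw [hW]; push_cast; nlinarith
    have hWp : W ^ (D + 1) = W ^ (2 * ⌈C⌉₊ + 3) * W := by rw [hDdef, pow_succ]
    calc γ * (((80 * (8 * a ^ 2 + 1) : ℕ) : ℝ) + 1) ^ (2 * ⌈C⌉₊ + 3)
        ≤ γ * W ^ (2 * ⌈C⌉₊ + 3) :=
          mul_le_mul_of_nonneg_left (pow_le_pow_left₀ (by positivity) hMW _) hγ0
      _ = criticalFugacity / W := by
          rw [hγ, hWp]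
          field_simp
      _ ≤ criticalFugacity / (16 * (2 * a + 1)) :=
          div_le_div_of_nonneg_left criticalFugacity_pos.le (by positivity) (by rw [hW]; nlinarith)
  -- induction over the rounds
  have claim : ∀ j, j ≤ nR a → ∃ M : ℕ, M ≤ 4 * j * (8 * a ^ 2 + 1) ∧
      γ ^ (4 * j) ≤ ∑ n ∈ Finset.range (M + 1),
          ∑ _ω ∈ (Zd.sawFun 2 n ![((xc a j : ℕ) : ℤ), ((yc a b j : ℕ) : ℤ)]).filter
            (fun ω => ∀ i ≤ n, ω i ∈ tubeSet a b), criticalFugacity ^ n := by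
    intro j
    induction j with
    | zero =>
      intro _
      refine ⟨0, Nat.zero_le _, ?_⟩
      rw [mul_zero, pow_zero]
      exact one_le_tubeMass_zero (P := fun p : Site 2 => p ∈ tubeSet a b) (zero_mem_tubeSet a b)
        (site_ext (by simp [xc]) (by simp [yc])) 0
    | succ j ih =>
      intro hj
      obtain ⟨M, hM, hB⟩ := ih (by omega)
      exact roundD hL hC' hD hba hγ0 hγ1 hγW hj hM hB
  obtain ⟨M, -, hB⟩ := claim (nR a) le_rfl
  rw [(xc_yc_nR hba).1, (xc_yc_nR hba).2] at hB
  refine ⟨M, le_trans ?_ (hB.trans (tubeMass_mono (P := fun p : Site 2 => p ∈ tubeSet a b)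
    (R := fun p : Site 2 => Metric.infDist (Site.toComplex p)
        (segment ℝ (Site.toComplex (0 : Site 2)) (Site.toComplex (![(a : ℤ), (b : ℤ)] : Site 2))) ≤
      max 1 (dist (Site.toComplex (0 : Site 2)) (Site.toComplex (![(a : ℤ), (b : ℤ)] : Site 2))) / 10 + 2)
    (fun p hp => hp) M _))⟩
  -- the constants: `c' ℓ₀^{-C'} = γ^{80} ≤ γ^{4n}`
  have h80 : 4 * nR a ≤ 80 := by unfold nR; omega
  calc (criticalFugacity / 721 ^ (D + 1)) ^ 80 * ℓ₀ ^ (-(((160 * (D + 1) : ℕ)) : ℝ)) = γ ^ 80 := by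
        rw [Real.rpow_neg hℓ0.le, Real.rpow_natCast, hγ, hW]
        field_simp
        ring
    _ ≤ γ ^ (4 * nR a) := pow_le_pow_of_le_one hγ0 hγ1 h80

end Summit.CriticalPhenomena.SAWScalingLimit.Theorems.TubeLowerBound.LassoRepair

end
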